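import Literature.NumberTheory.EllipticCurves.TwistedLValueSeries
import Literature.NumberTheory.EllipticCurves.CuspFormLFunctionFrickeProofs
import HarnessLib

/-!
# The Fricke transformation of the Eichler integral

For `f ∈ S₂(Γ₀(N))` with the pointwise Fricke eigen-property `f(-1/(Nτ)) = ε N τ² f(τ)`
(`ModularForms.IsFrickeEigen N f ε`, `TwistedLValueSeries`; for a newform `ε = ±1` is the
Atkin–Lehner eigenvalue), the tree's vertical-ray Eichler integral
`ModularForms.eichlerIntegral f τ = 2πi ∫_{i∞}^{τ} f(z) dz` (item C9) satisfies

`2πi ∫_{i∞}^{w_N τ} f = ε · 2πi ∫_{i∞}^{τ} f + {∞, 0}_f`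
(`IsFrickeEigen.eichlerIntegral_frickePoint`),

where `{∞, 0}_f = ModularForms.modularSymbol f 0 = 2π ∫₀^∞ f(it) dt` (`= L(f, 1)`). This is
Cremona's (2.10.6), `I_f(W(α), W(β)) = ε I_f(α, β)` ("by changing variables in the integrals"),
combined with `W(∞) = 0` and (2.11.1), `L(f, 1) = I_f(∞, 0)`:
`I_f(∞, Wτ) = I_f(∞, 0) + I_f(W∞, Wτ) = L(f, 1) + ε I_f(∞, τ)`. It is the analytic input of the
classical relation between complex conjugation and `w_N` on Heegner points (Gross 1984, §5;
Darmon 2004, Prop. 3.11), used in `HeegnerPointReflectionProofs`.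

## Proof

* `IsFrickeEigen.eichlerIntegral_frickePoint_sub_eq`:
  `z ↦ 2πi ∫_{i∞}^{-1/(Nz)} f - ε 2πi ∫_{i∞}^{z} f` is holomorphic on the upper half-plane with
  derivative `2πi f(-1/(Nz)) (Nz²)⁻¹ - ε 2πi f(z) = 0` (`hasDerivAt_eichlerIntegral` of
  `ModularSymbolsProofs`), hence constant
  (`IsOpen.is_const_of_deriv_eq_zero` on the connected half-plane).
* `IsFrickeEigen.modularSymbol_zero_eq` (Cremona (2.11.1), "`L(f, 1) = (ε_N - 1) I_f(i/√N)`"):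
  `{∞, 0}_f = (1 - ε) 2πi ∫_{i∞}^{i/√N} f`, by splitting `∫₀^∞ f(it) dt` at `t = 1/√N` and
  substituting `s = 1/(Nv)` in the lower piece, where `f(i/(Nv)) = -ε N v² f(iv)`
  (`integral_imagAxis_Ioc_eq`; the improper limits are taken along `B = 1/√N + n`, with
  `intervalIntegral.integral_deriv_smul_comp_of_deriv_nonpos`, `tendsto_setIntegral_of_monotone`,
  `intervalIntegral_tendsto_integral_Ioi`; the convergence of `∫₀^∞ f(it) dt` is
  `integrableOn_modularSymbol_integrand_holds` of `ModularSymbolsProofs`).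
* The constant is evaluated at the fixed point `i/√N` of `w_N`.

No definitions are introduced; `w_N` is `ModularForms.frickePoint N` (`TwistedLValueSeries`) or
equivalently the action of `ModularForms.glCast (ModularForms.frickeGL N)`
(`glCast_frickeGL_smul`).

## References

* [CremonaAlgorithms1997] J. E. Cremona, *Algorithms for modular elliptic curves*, 2nd ed.,
  Cambridge University Press (1997); full text `https://johncremona.github.io/book/fulltext/`,
  Chapter II, §2.10 (Prop. 2.10.1, (2.10.6), Prop. 2.10.3) and §2.11 ((2.11.1)).
* H. Darmon, *Rational Points on Modular Elliptic Curves*, CBMS 101 (2004), Prop. 2.11 and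
  (2.12) (`Φ_N(τ) = Φ_w(c ∑ aₙ/n qⁿ)`, `w_N`), Prop. 3.11.
-/

noncomputable section

open scoped MatrixGroups ModularForm UpperHalfPlane

open CongruenceSubgroup Complex Filter Topology Asymptotics Set MeasureTheory intervalIntegral

namespace Literature.NumberTheory.EllipticCurves.ModularForms

variable {N : ℕ} [NeZero N]

/-! ### `w_N` on `ℍ` and on `ℂ` -/

/-- The action of the Fricke matrix `w_N = (0 -1; N 0) ∈ GL(2, ℝ)⁺` on `ℍ` is the Fricke point:
`w_N • τ = -1/(Nτ) = frickePoint N τ`. [folklore] -/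
theorem glCast_frickeGL_smul (τ : ℍ) :
    glCast (frickeGL N : GL (Fin 2) ℚ) • τ = frickePoint N τ := by
  apply UpperHalfPlane.ext
  rw [coe_frickeGL_smul, coe_frickePoint, neg_div, one_div]

/-- `(ofComplex z : ℂ) = z` for `im z > 0`. [folklore] -/
lemma coe_ofComplex_of_im_pos {z : ℂ} (hz : 0 < z.im) :
    ((UpperHalfPlane.ofComplex z : ℍ) : ℂ) = z := by
  rw [UpperHalfPlane.ofComplex_apply_of_im_pos hz]

/-- `im (-1/(Nz)) > 0` for `im z > 0`. [folklore] -/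
lemma im_neg_one_div_pos' {z : ℂ} (hz : 0 < z.im) : 0 < (-1 / ((N : ℂ) * z)).im := by
  have h := im_neg_one_div_pos (N := N) (⟨z, hz⟩ : ℍ)
  exact h

/-- `frickePoint N (ofComplex z) = ofComplex (-1/(Nz))` for `im z > 0`. [folklore] -/
lemma frickePoint_ofComplex {z : ℂ} (hz : 0 < z.im) :
    frickePoint N (UpperHalfPlane.ofComplex z) = UpperHalfPlane.ofComplex (-1 / ((N : ℂ) * z)) := by
  rw [frickePoint_eq_ofComplex, coe_ofComplex_of_im_pos hz]

/-! ### The Fricke transformation of the Eichler integral: constancy -/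

/-- **`τ ↦ 2πi ∫_{i∞}^{w_N τ} f - ε 2πi ∫_{i∞}^{τ} f` is constant on `ℍ`** for `f ∈ S₂(Γ₀(N))` with
the pointwise Fricke eigen-property `f(-1/(Nτ)) = ε N τ² f(τ)` (`IsFrickeEigen`): the derivative of
`z ↦ 2πi ∫_{i∞}^{-1/(Nz)} f - ε 2πi ∫_{i∞}^{z} f` is `2πi f(-1/(Nz)) (Nz²)⁻¹ - ε 2πi f(z) = 0`
(`hasDerivAt_eichlerIntegral`) on the connected upper half-plane (Cremona 1997, §2.10, (2.10.6):
"`I_f(W(α), W(β)) = ε I_f(α, β)` … by changing variables in the integrals").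
[cite: CremonaAlgorithms1997, §2.10 (2.10.6)] -/
theorem IsFrickeEigen.eichlerIntegral_frickePoint_sub_eq {f : CuspForm (Gamma0 N) 2} {ε : ℂ}
    (hW : IsFrickeEigen N f ε) (τ τ' : ℍ) :
    eichlerIntegral f (frickePoint N τ) - ε * eichlerIntegral f τ =
      eichlerIntegral f (frickePoint N τ') - ε * eichlerIntegral f τ' := by
  set U : Set ℂ := {z : ℂ | 0 < z.im} with hU
  have hUo : IsOpen U := isOpen_lt continuous_const Complex.continuous_im
  have hUc : IsPreconnected U := (convex_halfSpace_im_gt 0).isPreconnected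
  set F : ℂ → ℂ := fun w ↦ eichlerIntegral f (UpperHalfPlane.ofComplex w) with hF
  set w : ℂ → ℂ := fun z ↦ -1 / ((N : ℂ) * z) with hw
  set G : ℂ → ℂ := fun z ↦ F (w z) - ε * F z with hG
  have hN0 : (N : ℂ) ≠ 0 := by exact_mod_cast NeZero.ne N
  have hw_eq : w = fun z ↦ -(N : ℂ)⁻¹ * z⁻¹ := by
    funext z
    simp only [hw, div_eq_mul_inv, mul_inv, neg_mul, one_mul]
  -- derivative of `w`
  have hw' : ∀ z ∈ U, HasDerivAt w (((N : ℂ) * z ^ 2)⁻¹) z := by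
    intro z hz
    have hz0 : z ≠ 0 := by rintro rfl; simp [hU] at hz
    rw [hw_eq]
    have h := (hasDerivAt_inv hz0).const_mul (-(N : ℂ)⁻¹)
    rwa [neg_mul_neg, ← mul_inv] at h
  -- `G' = 0` on `U`
  have hG' : ∀ z ∈ U, HasDerivAt G 0 z := by
    intro z hz
    have hz' : 0 < z.im := hz
    have hwz : 0 < (w z).im := im_neg_one_div_pos' hz'
    have hFw := (hasDerivAt_eichlerIntegral f hwz).comp z (hw' z hz)
    have hFz := hasDerivAt_eichlerIntegral f hz'
    have h : HasDerivAt G (2 * Real.pi * Complex.I * f (UpperHalfPlane.ofComplex (w z)) *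
        ((N : ℂ) * z ^ 2)⁻¹ -
          ε * (2 * Real.pi * Complex.I * f (UpperHalfPlane.ofComplex z))) z :=
      hFw.sub (hFz.const_mul ε)
    refine h.congr_deriv ?_
    have hz0 : z ≠ 0 := by rintro rfl; simp [hU] at hz
    have key : f (UpperHalfPlane.ofComplex (w z)) =
        ε * (N : ℂ) * z ^ 2 * f (UpperHalfPlane.ofComplex z) := by
      have := hW (UpperHalfPlane.ofComplex z)
      rw [frickePoint_ofComplex hz', coe_ofComplex_of_im_pos hz'] at this
      exact this
    rw [key]
    field_simp
    ring
  have hGd : DifferentiableOn ℂ G U := fun z hz ↦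
    (hG' z hz).differentiableAt.differentiableWithinAt
  have hGc := hUo.is_const_of_deriv_eq_zero hUc hGd (fun z hz ↦ (hG' z hz).deriv)
    (show (τ : ℂ) ∈ U from τ.im_pos) (show (τ' : ℂ) ∈ U from τ'.im_pos)
  simp only [hG, hF, hw, ← frickePoint_eq_ofComplex, UpperHalfPlane.ofComplex_apply] at hGc
  exact hGc

/-! ### The cusp `0`: `{∞, 0}_f = (1 - ε) · 2πi ∫_{i∞}^{i/√N} f` -/

/-- Translation of a ray integral: `∫₀^∞ g(b + t) dt = ∫_b^∞ g(s) ds` (translation invariance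
of Lebesgue measure). [folklore] -/
lemma integral_Ioi_comp_add_left (g : ℝ → ℂ) (b : ℝ) :
    ∫ t in Ioi (0 : ℝ), g (b + t) = ∫ s in Ioi b, g s := by
  rw [← MeasureTheory.integral_indicator measurableSet_Ioi,
    ← MeasureTheory.integral_indicator measurableSet_Ioi]
  have : (Ioi (0 : ℝ)).indicator (fun t ↦ g (b + t)) = fun t ↦ (Ioi b).indicator g (b + t) := by
    funext t
    by_cases ht : t ∈ Ioi 0
    · rw [indicator_of_mem ht, indicator_of_mem (show b + t ∈ Ioi b by simpa using ht)]
    · rw [indicator_of_notMem ht, indicator_of_notMem (show b + t ∉ Ioi b by simpa using ht)]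
  rw [this]
  exact integral_add_left_eq_self _ b

/-- `t ↦ f(it)` is integrable on `(0, ∞)` (the named fact `integrableOn_modularSymbol_integrand`
at the cusp `0`, proved in `ModularSymbolsProofs`). [folklore] -/
lemma integrableOn_imagAxis (f : CuspForm (Gamma0 N) 2) :
    IntegrableOn (fun t : ℝ ↦ f (UpperHalfPlane.ofComplex (Complex.I * t))) (Ioi 0) := by
  have h := integrableOn_modularSymbol_integrand_holds f 0
  refine h.congr_fun (fun t _ ↦ ?_) measurableSet_Ioi
  simp [mul_comm]

/-- `w_N` on the imaginary axis: `frickePoint N (iv) = i/(Nv)` for `v > 0`. [folklore] -/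
lemma frickePoint_ofComplex_I_mul {v : ℝ} (hv : 0 < v) :
    frickePoint N (UpperHalfPlane.ofComplex (Complex.I * v)) =
      UpperHalfPlane.ofComplex (Complex.I * (((N : ℝ) * v)⁻¹ : ℝ)) := by
  have h1 : 0 < (Complex.I * v).im := by simpa using hv
  rw [frickePoint_ofComplex h1]
  congr 1
  push_cast
  rw [div_eq_mul_inv]
  simp only [mul_inv, Complex.inv_I]
  ring

/-- **The substitution `s = 1/(Nv)` on the imaginary axis**: if `f(-1/(Nτ)) = ε N τ² f(τ)` then
`∫₀^{1/√N} f(is) ds = -ε ∫_{1/√N}^∞ f(iv) dv` (`f(i/(Nv)) = -ε N v² f(iv)` and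
`ds = -dv/(Nv²)`; the improper limits at `s → 0⁺`, `v → ∞` are taken along `B = 1/√N + n`)
(Cremona 1997, §2.11, proof of (2.11.1)). [cite: CremonaAlgorithms1997, §2.11 (2.11.1)] -/
lemma IsFrickeEigen.integral_imagAxis_Ioc_eq {f : CuspForm (Gamma0 N) 2} {ε : ℂ}
    (hW : IsFrickeEigen N f ε) :
    ∫ s in Ioc (0 : ℝ) (Real.sqrt N)⁻¹, f (UpperHalfPlane.ofComplex (Complex.I * s)) =
      -ε * ∫ v in Ioi (Real.sqrt N)⁻¹, f (UpperHalfPlane.ofComplex (Complex.I * v)) := by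
  set g : ℝ → ℂ := fun t ↦ f (UpperHalfPlane.ofComplex (Complex.I * t)) with hg_def
  set b : ℝ := (Real.sqrt N)⁻¹ with hb_def
  have hN : (0 : ℝ) < N := by exact_mod_cast NeZero.pos N
  have hsq : 0 < Real.sqrt N := Real.sqrt_pos.mpr hN
  have hb : 0 < b := inv_pos.mpr hsq
  have hNb : (N : ℝ) * b = Real.sqrt N := by
    rw [hb_def, ← div_eq_mul_inv, div_eq_iff hsq.ne', Real.mul_self_sqrt hN.le]
  have hg : IntegrableOn g (Ioi 0) := integrableOn_imagAxis f
  -- the functional equation on the imaginary axis: `g (1/(Nv)) = -ε N v² g v`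
  have hgw : ∀ v : ℝ, 0 < v → g (((N : ℝ) * v)⁻¹) = -ε * ((N : ℂ) * v ^ 2) * g v := by
    intro v hv
    have h := hW (UpperHalfPlane.ofComplex (Complex.I * v))
    rw [frickePoint_ofComplex_I_mul hv,
      coe_ofComplex_of_im_pos (show 0 < (Complex.I * (v : ℂ)).im by simpa using hv)] at h
    simp only [hg_def]
    rw [h, mul_pow, Complex.I_sq]
    ring
  -- D1: the substitution on `[b, B]`
  set φ : ℝ → ℝ := fun v ↦ ((N : ℝ) * v)⁻¹ with hφ
  set φ' : ℝ → ℝ := fun v ↦ -((N : ℝ) * v ^ 2)⁻¹ with hφ'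
  have hφd : ∀ v : ℝ, 0 < v → HasDerivAt φ (φ' v) v := by
    intro v hv
    have hv0 : v ≠ 0 := hv.ne'
    have hφ_eq : φ = fun v ↦ (N : ℝ)⁻¹ * v⁻¹ := by funext v; simp only [hφ, mul_inv]
    rw [hφ_eq]
    have h := (hasDerivAt_inv hv0).const_mul ((N : ℝ)⁻¹)
    exact h.congr_deriv (by simp only [hφ']; rw [mul_neg, ← mul_inv])
  have hφb : φ b = b := by
    simp only [hφ]
    rw [hNb, hb_def]
  have hD1 : ∀ n : ℕ, ∫ s in Ioc (φ (b + n)) b, g s = -ε * ∫ v in b..(b + n), g v := by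
    intro n
    have hB : b ≤ b + n := by simp
    have hpos : ∀ v ∈ uIcc b (b + n), 0 < v := fun v hv ↦ by
      rw [uIcc_of_le hB] at hv
      exact hb.trans_le hv.1
    have hcont : ContinuousOn φ (uIcc b (b + n)) := by
      simp only [hφ]
      refine ContinuousOn.inv₀ (by fun_prop) fun v hv ↦ ?_
      exact mul_ne_zero hN.ne' (hpos v hv).ne'
    have hderiv : ∀ v ∈ Ioo (min b (b + n)) (max b (b + n)), HasDerivAt φ (φ' v) v := by
      intro v hv
      rw [min_eq_left hB, max_eq_right hB] at hv
      exact hφd v (hb.trans hv.1)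
    have hnonpos : ∀ v ∈ Ioo (min b (b + n)) (max b (b + n)), φ' v ≤ 0 := by
      intro v _
      simp only [hφ']
      have : 0 ≤ ((N : ℝ) * v ^ 2)⁻¹ := by positivity
      linarith
    have hsub := integral_deriv_smul_comp_of_deriv_nonpos (g := g) hcont hderiv hnonpos
    -- the integrand is `ε g v`
    have hint : ∫ v in b..(b + n), φ' v • (g ∘ φ) v = ε * ∫ v in b..(b + n), g v := by
      rw [← intervalIntegral.integral_const_mul]
      refine intervalIntegral.integral_congr fun v hv ↦ ?_
      have hv0 : 0 < v := hpos v hv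
      simp only [Function.comp_apply, hφ', hφ, Complex.real_smul]
      rw [hgw v hv0]
      have hv' : (v : ℂ) ≠ 0 := by exact_mod_cast hv0.ne'
      have hN' : (N : ℂ) ≠ 0 := by exact_mod_cast hN.ne'
      push_cast
      field_simp
    have hle : φ (b + n) ≤ b := by
      show ((N : ℝ) * (b + n))⁻¹ ≤ b
      calc ((N : ℝ) * (b + n))⁻¹ ≤ ((N : ℝ) * b)⁻¹ :=
            inv_anti₀ (mul_pos hN hb)
              (mul_le_mul_of_nonneg_left (le_add_of_nonneg_right (Nat.cast_nonneg n)) hN.le)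
        _ = b := by rw [hNb, hb_def]
    rw [hint, hφb, intervalIntegral.integral_symm (φ (b + n)) b,
      intervalIntegral.integral_of_le hle] at hsub
    linear_combination hsub
  -- D2: the limit `n → ∞`
  have hmono : Monotone fun n : ℕ ↦ Ioc (φ (b + n)) b := by
    intro m n hmn
    apply Ioc_subset_Ioc _ le_rfl
    simp only [hφ]
    gcongr
  have hU : (⋃ n : ℕ, Ioc (φ (b + n)) b) = Ioc 0 b := by
    ext x
    simp only [mem_iUnion, mem_Ioc]
    constructor
    · rintro ⟨n, h1, h2⟩
      refine ⟨lt_trans ?_ h1, h2⟩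
      simp only [hφ]
      positivity
    · rintro ⟨h1, h2⟩
      obtain ⟨n, hn⟩ := exists_nat_gt (((N : ℝ) * x)⁻¹ - b)
      refine ⟨n, ?_, h2⟩
      simp only [hφ]
      rw [inv_lt_comm₀ (by positivity) h1]
      calc x⁻¹ = (N : ℝ) * ((N : ℝ) * x)⁻¹ := by field_simp
        _ < (N : ℝ) * (b + n) := by gcongr; linarith
  have hlim1 : Tendsto (fun n : ℕ ↦ ∫ s in Ioc (φ (b + n)) b, g s) atTop
      (𝓝 (∫ s in Ioc 0 b, g s)) := by
    have h := tendsto_setIntegral_of_monotone (fun n ↦ measurableSet_Ioc) hmono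
      (hU ▸ hg.mono_set Ioc_subset_Ioi_self)
    rwa [hU] at h
  have hlim2 : Tendsto (fun n : ℕ ↦ -ε * ∫ v in b..(b + n), g v) atTop
      (𝓝 (-ε * ∫ v in Ioi b, g v)) :=
    (intervalIntegral_tendsto_integral_Ioi b (hg.mono_set (Ioi_subset_Ioi hb.le))
      (tendsto_atTop_add_const_left atTop b tendsto_natCast_atTop_atTop)).const_mul (-ε)
  exact tendsto_nhds_unique (hlim1.congr hD1) hlim2

/-- **`{∞, 0}_f = (1 - ε) · 2πi ∫_{i∞}^{i/√N} f`** (Cremona 1997, §2.11, (2.11.1):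
"`L(f, 1) = I_f(∞, 0) = (ε_N - 1) I_f(i/√N)`" with `I_f(α) = ∫_α^∞ 2πi f dz = -2πi ∫_{i∞}^α f`), for
`f ∈ S₂(Γ₀(N))` with `f(-1/(Nτ)) = ε N τ² f(τ)`: split `∫₀^∞ f(it) dt` at `1/√N` and substitute in
the lower piece (`integral_imagAxis_Ioc_eq`). [cite: CremonaAlgorithms1997, §2.11 (2.11.1)] -/
theorem IsFrickeEigen.modularSymbol_zero_eq {f : CuspForm (Gamma0 N) 2} {ε : ℂ}
    (hW : IsFrickeEigen N f ε) :
    modularSymbol f 0 =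
      (1 - ε) *
        eichlerIntegral f (UpperHalfPlane.ofComplex (Complex.I * ((Real.sqrt N)⁻¹ : ℝ))) := by
  set g : ℝ → ℂ := fun t ↦ f (UpperHalfPlane.ofComplex (Complex.I * t)) with hg_def
  set b : ℝ := (Real.sqrt N)⁻¹ with hb_def
  have hb : 0 < b := inv_pos.mpr (Real.sqrt_pos.mpr (by exact_mod_cast NeZero.pos N))
  have hg : IntegrableOn g (Ioi 0) := integrableOn_imagAxis f
  have hM : modularSymbol f 0 = 2 * Real.pi * ∫ t in Ioi (0 : ℝ), g t := by
    rw [modularSymbol]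
    congr 1
    refine setIntegral_congr_fun measurableSet_Ioi fun t _ ↦ ?_
    simp only [hg_def, Rat.cast_zero, zero_add, mul_comm (t : ℂ)]
  have hE : eichlerIntegral f (UpperHalfPlane.ofComplex (Complex.I * (b : ℝ))) =
      2 * Real.pi * ∫ t in Ioi b, g t := by
    rw [eichlerIntegral, ← integral_Ioi_comp_add_left g b,
      coe_ofComplex_of_im_pos (show 0 < (Complex.I * ((b : ℝ) : ℂ)).im by simpa using hb)]
    congr 1
    refine setIntegral_congr_fun measurableSet_Ioi fun t _ ↦ ?_
    simp only [hg_def]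
    push_cast
    ring_nf
  have hsplit : ∫ t in Ioi (0 : ℝ), g t = (∫ t in Ioc 0 b, g t) + ∫ t in Ioi b, g t := by
    have h := integral_Ioi_sub_Ioi hg hb.le
    rw [intervalIntegral.integral_of_le hb.le] at h
    linear_combination h
  rw [hM, hE, hsplit, hW.integral_imagAxis_Ioc_eq]
  ring

/-- `w_N` fixes `i/√N`. [folklore] -/
lemma frickePoint_ofComplex_I_mul_inv_sqrt :
    frickePoint N (UpperHalfPlane.ofComplex (Complex.I * ((Real.sqrt N)⁻¹ : ℝ))) =
      UpperHalfPlane.ofComplex (Complex.I * ((Real.sqrt N)⁻¹ : ℝ)) := by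
  have hN : (0 : ℝ) < N := by exact_mod_cast NeZero.pos N
  have hs : 0 < Real.sqrt N := Real.sqrt_pos.mpr hN
  rw [frickePoint_ofComplex_I_mul (inv_pos.mpr hs)]
  congr 3
  have hNs : (N : ℝ) * (Real.sqrt N)⁻¹ = Real.sqrt N := by
    rw [← div_eq_mul_inv, div_eq_iff hs.ne', Real.mul_self_sqrt hN.le]
  rw [hNs]

/-- **The Fricke transformation of the Eichler integral** (Cremona 1997, §2.10, (2.10.6) with §2.11,
(2.11.1)): for `f ∈ S₂(Γ₀(N))` with `f(-1/(Nτ)) = ε N τ² f(τ)` on `ℍ`,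
`2πi ∫_{i∞}^{w_N τ} f = ε · 2πi ∫_{i∞}^{τ} f + {∞, 0}_f`
(in Cremona's notation `I_f(∞, Wτ) = I_f(∞, 0) + I_f(W∞, Wτ) = L(f, 1) + ε I_f(∞, τ)`): by
`eichlerIntegral_frickePoint_sub_eq` the difference is constant, and at the fixed point `i/√N` of
`w_N` it equals `(1 - ε) 2πi ∫_{i∞}^{i/√N} f = {∞, 0}_f` (`modularSymbol_zero_eq`).
[cite: CremonaAlgorithms1997, §2.10 (2.10.6) and §2.11 (2.11.1)] -/
theorem IsFrickeEigen.eichlerIntegral_frickePoint {f : CuspForm (Gamma0 N) 2} {ε : ℂ}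
    (hW : IsFrickeEigen N f ε) (τ : ℍ) :
    eichlerIntegral f (frickePoint N τ) = ε * eichlerIntegral f τ + modularSymbol f 0 := by
  have h := hW.eichlerIntegral_frickePoint_sub_eq τ
    (UpperHalfPlane.ofComplex (Complex.I * ((Real.sqrt N)⁻¹ : ℝ)))
  rw [frickePoint_ofComplex_I_mul_inv_sqrt, hW.modularSymbol_zero_eq] at *
  linear_combination h

/-- The same for the `GL(2, ℝ)⁺`-action of `w_N` on `ℍ`.
[cite: CremonaAlgorithms1997, §2.10 (2.10.6)] -/
theorem IsFrickeEigen.eichlerIntegral_frickeGL_smul {f : CuspForm (Gamma0 N) 2} {ε : ℂ}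
    (hW : IsFrickeEigen N f ε) (τ : ℍ) :
    eichlerIntegral f (glCast (frickeGL N : GL (Fin 2) ℚ) • τ) =
      ε * eichlerIntegral f τ + modularSymbol f 0 := by
  rw [glCast_frickeGL_smul, hW.eichlerIntegral_frickePoint]

end Literature.NumberTheory.EllipticCurves.ModularForms

end
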